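import Literature.MathematicalPhysics.QuantumLattice.DWaveOrderParameterProofs
import HarnessLib

/-!
# F-B′: an energy WINDOW at one positive source strength is a CEILING on the Koma–Tasaki `d`-wave
# order parameter — `m_d(U, μ) ≤ (u₀ − ℓ_H) / (2(H − h))`

HONEST FRAMING: first certified bounds on pairing observables; not a superconductivity verdict; every
number certified (two lineages + referee) or labelled float. Crew hubbard-obs (D-0042), seat hubbard-obs-p1
(`prover-hubbard-obs-p1-g0-0`); the chain was posed by the cell lead (HOME/TARGET.md v0.1 §4 F-B′, idea
credited to mbsolver l5-lit-2 METHODS G30-6 "(SEC) box") and is typed AND proved here from tree lemmas.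
Zero compute; no definition; no named fact; no `sorry`.

Objects (tree, `Literature/MathematicalPhysics/QuantumLattice/DWaveSource*.lean`): the grand-canonical
torus Hamiltonian with a `d`-wave pair source `dWaveSourceTorus L U μ h = H(1,U) − μN − h(Δ_d + Δ_d†)`,
its ground energy `E_L(h)`, the sourced pair density `m_L(h) = dWaveSourceDensity L U μ h = Re ω₀(Δ_d)/L²`
and the Koma–Tasaki order parameter `dWaveOrderParameter U μ = liminf_{h↓0} liminf_L m_{L+1}(h)`.

The chain (every link a tree lemma): for `0 < h < H`,
  (1) `2(H − h) L² · m_L(h) ≤ E_L(h) − E_L(H)`            (`dWaveSourceDensity_mul_le_groundEnergy_drop`, concavity),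
  (2) `E_L(h) ≤ E_L(0)`                                    (`groundEnergy_dWaveSourceTorus_le`, gauge symmetry),
  (3) an ENERGY WINDOW, eventually in `L`: `E_{L}(0) ≤ u₀ L²` (any grand-canonical source-free UPPER
      bound — e.g. a certified canonical upper `e_up(n₀) − μ n₀` at any density `n₀`, by the Legendre
      inequality `E_L^{GC}(0) ≤ E_L(N₀) − μ N₀`) and `ℓ L² ≤ E_L(H)` (a certified LOWER bound for the
      sourced problem, e.g. a gauge-broken translation-invariant SDP certificate valid on all large tori),
  ⇒ `m_{L}(h) ≤ (u₀ − ℓ)/(2(H − h))` eventually, hence (4) `liminf_L m_{L+1}(h) ≤ (u₀ − ℓ)/(2(H − h))` and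
  (5) `dWaveOrderParameter U μ ≤ (u₀ − ℓ)/(2(H − h))`     (`dWaveOrderParameter_le_liminf`: the outer
      liminf is below the inner one at EVERY `h > 0`).
Statements: `dWaveSourceDensity_le_of_energy_window` (finite `L`), `liminf_dWaveSourceDensity_le_of_window`,
`dWaveOrderParameter_le_of_sourced_energy_window` (the F-B′ ceiling). Quality (planning, not a claim):
LINEAR in the energy slacks, `m* ≤ m̄_{[h,H]} + (ε_up + ε_lo)/(2(H − h))`; a ceiling says nothing about the
presence of pairing. Barrier placement: `SourcedOrderWithoutGroundStateLRO` concerns FLOORS; this is a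
ceiling (`OrderParameterInvisibleToGroundStateConstraints`, evasions (iii)+(iv)).

References: T. Koma, H. Tasaki, J. Stat. Phys. 76 (1994) 745, §1 (order parameter with a
symmetry-breaking field; energy–order-parameter sandwich); H. Tasaki, J. Stat. Phys. (1998) §6.
-/

noncomputable section

namespace Summit.Ventures.CertifiedManyBodySolver.Observables

open Literature.MathematicalPhysics.QuantumLattice Filter Topology

/-- **Finite volume**: for `0 < h < H`, an upper bound `E_L(0) ≤ u₀ L²` on the source-free grand-canonical
ground energy and a lower bound `ℓ L² ≤ E_L(H)` on the ground energy at source `H` give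
`m_L(h) ≤ (u₀ − ℓ)/(2(H − h))` (links (1)–(3) of the module docstring). -/
theorem dWaveSourceDensity_le_of_energy_window (L : ℕ) [NeZero L] (U μ : ℝ) {h H u₀ ℓ : ℝ}
    (hhH : h < H)
    (hu : (dWaveSourceTorus L U μ 0).groundEnergy ≤ u₀ * (L : ℝ) ^ 2)
    (hl : ℓ * (L : ℝ) ^ 2 ≤ (dWaveSourceTorus L U μ H).groundEnergy) :
    dWaveSourceDensity L U μ h ≤ (u₀ - ℓ) / (2 * (H - h)) := by
  have h1 := dWaveSourceDensity_mul_le_groundEnergy_drop (L := L) U μ h H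
  have h2 := groundEnergy_dWaveSourceTorus_le (L := L) U μ h
  have hL : (0 : ℝ) < (L : ℝ) ^ 2 := by
    have : (0 : ℝ) < (L : ℝ) := by exact_mod_cast Nat.pos_of_ne_zero (NeZero.ne L)
    positivity
  have hHh : 0 < H - h := sub_pos.2 hhH
  rw [le_div_iff₀ (by positivity)]
  -- `(H - h) · 2L² · m ≤ E(h) − E(H) ≤ E(0) − E(H) ≤ (u₀ − ℓ) L²`
  have h3 : (H - h) * (2 * (L : ℝ) ^ 2 * dWaveSourceDensity L U μ h) ≤ (u₀ - ℓ) * (L : ℝ) ^ 2 := by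
    nlinarith [h1, h2, hu, hl]
  -- divide by `L² > 0`
  by_contra hcon
  push Not at hcon
  have : (u₀ - ℓ) * (L : ℝ) ^ 2 < (H - h) * (2 * (L : ℝ) ^ 2 * dWaveSourceDensity L U μ h) := by
    have := mul_lt_mul_of_pos_right hcon hL
    nlinarith [this]
  linarith

/-- **Inner liminf**: under ENERGY WINDOWS holding for all large tori — `E_{L+1}(0) ≤ u₀ (L+1)²` and
`ℓ (L+1)² ≤ E_{L+1}(H)` eventually — `liminf_L m_{L+1}(h) ≤ (u₀ − ℓ)/(2(H − h))` for `0 ≤ h < H`. -/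
theorem liminf_dWaveSourceDensity_le_of_window (U μ : ℝ) {h H u₀ ℓ : ℝ} (hh : 0 ≤ h) (hhH : h < H)
    (hu : ∀ᶠ L : ℕ in atTop, (dWaveSourceTorus (L + 1) U μ 0).groundEnergy ≤ u₀ * (((L + 1 : ℕ) : ℝ)) ^ 2)
    (hl : ∀ᶠ L : ℕ in atTop, ℓ * (((L + 1 : ℕ) : ℝ)) ^ 2 ≤ (dWaveSourceTorus (L + 1) U μ H).groundEnergy) :
    liminf (fun L : ℕ => dWaveSourceDensity (L + 1) U μ h) atTop ≤ (u₀ - ℓ) / (2 * (H - h)) := by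
  have hev : ∀ᶠ L : ℕ in atTop, dWaveSourceDensity (L + 1) U μ h ≤ (u₀ - ℓ) / (2 * (H - h)) := by
    filter_upwards [hu, hl] with L huL hlL
    exact dWaveSourceDensity_le_of_energy_window (L + 1) U μ hhH huL hlL
  refine liminf_le_of_frequently_le hev.frequently ?_
  exact isBoundedUnder_of_eventually_ge (a := 0)
    (Eventually.of_forall fun L => dWaveSourceDensity_nonneg U μ hh)

/-- **F-B′ — the sourced energy window is a ceiling on the Koma–Tasaki `d`-wave order parameter.**
For `0 < h < H`, if eventually in `L` the source-free grand-canonical torus ground energy obeys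
`E_{L+1}(0) ≤ u₀ (L+1)²` and the ground energy at source `H` obeys `ℓ (L+1)² ≤ E_{L+1}(H)`, then
`dWaveOrderParameter U μ ≤ (u₀ − ℓ)/(2(H − h))`. (The bound is best as `h ↓ 0`: `≤ (u₀ − ℓ)/(2H)` in the
limit, but the order parameter only sees `h > 0`, so the statement is kept at a fixed `0 < h < H`.) -/
theorem dWaveOrderParameter_le_of_sourced_energy_window (U μ : ℝ) {h H u₀ ℓ : ℝ} (hh : 0 < h) (hhH : h < H)
    (hu : ∀ᶠ L : ℕ in atTop, (dWaveSourceTorus (L + 1) U μ 0).groundEnergy ≤ u₀ * (((L + 1 : ℕ) : ℝ)) ^ 2)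
    (hl : ∀ᶠ L : ℕ in atTop, ℓ * (((L + 1 : ℕ) : ℝ)) ^ 2 ≤ (dWaveSourceTorus (L + 1) U μ H).groundEnergy) :
    dWaveOrderParameter U μ ≤ (u₀ - ℓ) / (2 * (H - h)) :=
  (dWaveOrderParameter_le_liminf U μ hh).trans (liminf_dWaveSourceDensity_le_of_window U μ hh.le hhH hu hl)

/-- The same ceiling with BOTH energy bounds taken at positive sources `0 < h < H` (no appeal to the
source-free problem): `E_{L+1}(h) ≤ u_h (L+1)²` and `ℓ (L+1)² ≤ E_{L+1}(H)` eventually give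
`dWaveOrderParameter U μ ≤ (u_h − ℓ)/(2(H − h))` — the form fed by a variational (upper-crew) number at
source `h`. -/
theorem dWaveOrderParameter_le_of_sourced_energy_window' (U μ : ℝ) {h H uh ℓ : ℝ} (hh : 0 < h) (hhH : h < H)
    (hu : ∀ᶠ L : ℕ in atTop, (dWaveSourceTorus (L + 1) U μ h).groundEnergy ≤ uh * (((L + 1 : ℕ) : ℝ)) ^ 2)
    (hl : ∀ᶠ L : ℕ in atTop, ℓ * (((L + 1 : ℕ) : ℝ)) ^ 2 ≤ (dWaveSourceTorus (L + 1) U μ H).groundEnergy) :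
    dWaveOrderParameter U μ ≤ (uh - ℓ) / (2 * (H - h)) := by
  refine (dWaveOrderParameter_le_liminf U μ hh).trans ?_
  have hev : ∀ᶠ L : ℕ in atTop, dWaveSourceDensity (L + 1) U μ h ≤ (uh - ℓ) / (2 * (H - h)) := by
    filter_upwards [hu, hl] with L huL hlL
    have h1 := dWaveSourceDensity_mul_le_groundEnergy_drop (L := L + 1) U μ h H
    have hL : (0 : ℝ) < (((L + 1 : ℕ) : ℝ)) ^ 2 := by positivity
    have hHh : 0 < H - h := sub_pos.2 hhH
    rw [le_div_iff₀ (by positivity)]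
    have h3 : (H - h) * (2 * (((L + 1 : ℕ) : ℝ)) ^ 2 * dWaveSourceDensity (L + 1) U μ h) ≤
        (uh - ℓ) * (((L + 1 : ℕ) : ℝ)) ^ 2 := by nlinarith [h1, huL, hlL]
    by_contra hcon
    push Not at hcon
    have := mul_lt_mul_of_pos_right hcon hL
    nlinarith [this, h3]
  refine liminf_le_of_frequently_le hev.frequently ?_
  exact isBoundedUnder_of_eventually_ge (a := 0)
    (Eventually.of_forall fun L => dWaveSourceDensity_nonneg U μ hh.le)

end Summit.Ventures.CertifiedManyBodySolver.Observables

end
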